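import Literature.Probability.LatticeModels.SixVertexGFFCorrelations
import Literature.Probability.LatticeModels.SixVertexSpectralMeasureSpace
import Literature.Probability.LatticeModels.SixVertexSpectralIntegrands
import Literature.Analysis.SpecialFunctions.FrullaniExp
import Mathlib.Analysis.SpecialFunctions.Integrals.Basic

/-!
# The spectral measure of the Gaussian free field (DKLM 2026, Part II §1.1 and Theorem 53)

H. Duminil-Copin, K. K. Kozlowski, P. Lammers, I. Manolescu, *Gaussian free field convergence of
the six-vertex model with `-1 ≤ Δ ≤ -1/2`*, arXiv:2603.06268 (2026) [DKLM2026SixVertexGFF]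
(`paper:arxiv-2603.06268`, chunks p0022, p0036):

> `Ψ₂(u) = ∫ (e^{-ax₂-iby₂} - 1) e^{-ax₁'-iby₁'} (1 - e^{-ax₁-iby₁}) dμ(a,b)` […] it is a simple
> exercise (see also the proof of Theorem (thm:main measure)) to check from the expression above
> that `Ψ₂ = σ²·Ψ₂^GFF` for some `σ > 0` if and only if `μ[{b² ≠ a²}] = 0` and the density of the
> first marginal of `μ` is `σ²/(2πa) da`.
>
> **Theorem 53.** […] `lim_{δ→0} lim_{L→∞} μ_L^{(δ)} = ½(δ_{b=a} + δ_{b=-a}) · σ²/(2πa) da`.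

This file constructs the limiting measure **`μ_σ := ½(δ_{b=a} + δ_{b=-a}) ⊗ σ²/(2πa) 𝟙_{a>0} da`**
on `ℝ × ℝ` (`gffSpectralMeasure σ`) and proves the "if" direction of the exercise: for every
horizontally ordered `u = (u₁,u₁',u₂,u₂')` with `x₁' > 0`,

`∫ χ_u dμ_σ = σ² Ψ₂^GFF(u)` (`integral_chiCont_gffSpectralMeasure`),

where `χ_u = chiCont` (`SixVertexSpectralIntegrands.lean`) and `Ψ₂^GFF = gffKPoint 2`
(`SixVertexGFF.lean`, `gffKPoint_two`: `G(u₁',u₂') - G(u₁,u₂') - G(u₁',u₂) + G(u₁,u₂)`,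
`G = -(1/2π) log|·|`). The computation is the exponential Frullani integral
(`Literature.Analysis.SpecialFunctions.integral_frullani_cexp`): on the diagonal `b = a`,
`χ_u(a,a)/a` is the sum of the two Frullani kernels for `(w₂+w', w')` and `(w'+w₁, w₁+w'+w₂)`
(`w₁ = u₁'-u₁`, `w' = u₂-u₁'`, `w₂ = u₂'-u₂` as complex numbers), the anti-diagonal contributes the
complex conjugate, and `Re Log w = log|w|`. We also record that `μ_σ` lies in the space `𝓜_{c,C}` of
Definition 29 (`gffSpectralMeasure_mem_dklmSpaceM`; bound (ii) is vacuous on `{|b| = a}`).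

## References

* H. Duminil-Copin, K. K. Kozlowski, P. Lammers, I. Manolescu, arXiv:2603.06268 (2026), Part II,
  §1.1 (the "simple exercise") and Theorem 53. [DKLM2026SixVertexGFF]
-/

noncomputable section

open MeasureTheory Set Filter Topology Complex
open scoped NNReal ENNReal
open Literature.Analysis.SpecialFunctions

namespace Literature.Probability.LatticeModels.SixVertex

/-! ## 1. The measure `μ_σ` -/

/-- The radial density `σ²/(2πa)` (as `ℝ≥0`; `0` for `a ≤ 0`). [cite: DKLM2026SixVertexGFF, Theorem 53] -/
def gffDensity (σ a : ℝ) : ℝ≥0 := Real.toNNReal (σ ^ 2 / (2 * Real.pi * a))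

/-- `σ²/(2πa) 𝟙_{a>0} da` as a measure on `ℝ`. [cite: DKLM2026SixVertexGFF, Theorem 53] -/
def gffRadial (σ : ℝ) : Measure ℝ := (volume.restrict (Ioi (0 : ℝ))).withDensity fun a => gffDensity σ a

/-- The diagonal embedding `a ↦ (a, a)`. [folklore] -/
def diagEmb (a : ℝ) : ℝ × ℝ := (a, a)

/-- The anti-diagonal embedding `a ↦ (a, -a)`. [folklore] -/
def adiagEmb (a : ℝ) : ℝ × ℝ := (a, -a)

/-- **The GFF spectral measure `μ_σ := ½(δ_{b=a} + δ_{b=-a}) ⊗ σ²/(2πa) 𝟙_{a>0} da`** on `ℝ × ℝ`.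
[cite: DKLM2026SixVertexGFF, Theorem 53 and Part II §1.1] -/
def gffSpectralMeasure (σ : ℝ) : Measure (ℝ × ℝ) :=
  (2⁻¹ : ℝ≥0∞) • ((gffRadial σ).map diagEmb + (gffRadial σ).map adiagEmb)

/-- The density is measurable. [folklore] -/
theorem measurable_gffDensity (σ : ℝ) : Measurable (gffDensity σ) := by
  unfold gffDensity; fun_prop

/-- The diagonal embedding is measurable. [folklore] -/
theorem measurable_diagEmb : Measurable diagEmb := measurable_id.prodMk measurable_id

/-- The anti-diagonal embedding is measurable. [folklore] -/
theorem measurable_adiagEmb : Measurable adiagEmb := measurable_id.prodMk measurable_neg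

/-- The density on `(0,∞)`: `σ²/(2πa)`. [cite: DKLM2026SixVertexGFF, Theorem 53] -/
theorem coe_gffDensity {σ a : ℝ} (ha : 0 < a) : (gffDensity σ a : ℝ) = σ ^ 2 / (2 * Real.pi * a) :=
  Real.coe_toNNReal _ (by positivity)

/-- **Integration against `μ_σ`**: `∫ f dμ_σ = ½ ∫₀^∞ (f(a,a) + f(a,-a)) σ²/(2πa) da` for continuous
`f` such that both restrictions are integrable against the density.
[cite: DKLM2026SixVertexGFF, Theorem 53] -/
theorem integral_gffSpectralMeasure {σ : ℝ} {f : ℝ × ℝ → ℂ} (hf : Continuous f)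
    (h1 : Integrable (fun a => gffDensity σ a • f (a, a)) (volume.restrict (Ioi (0 : ℝ))))
    (h2 : Integrable (fun a => gffDensity σ a • f (a, -a)) (volume.restrict (Ioi (0 : ℝ)))) :
    ∫ p, f p ∂gffSpectralMeasure σ =
      2⁻¹ * ((∫ a in Ioi (0 : ℝ), gffDensity σ a • f (a, a)) + ∫ a in Ioi (0 : ℝ), gffDensity σ a • f (a, -a)) := by
  have I1 : Integrable f ((gffRadial σ).map diagEmb) :=
    (integrable_map_measure hf.aestronglyMeasurable measurable_diagEmb.aemeasurable).2
      ((integrable_withDensity_iff_integrable_smul (measurable_gffDensity σ)).2 h1)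
  have I2 : Integrable f ((gffRadial σ).map adiagEmb) :=
    (integrable_map_measure hf.aestronglyMeasurable measurable_adiagEmb.aemeasurable).2
      ((integrable_withDensity_iff_integrable_smul (measurable_gffDensity σ)).2 h2)
  rw [gffSpectralMeasure, integral_smul_measure, integral_add_measure I1 I2,
    integral_map measurable_diagEmb.aemeasurable hf.aestronglyMeasurable,
    integral_map measurable_adiagEmb.aemeasurable hf.aestronglyMeasurable, gffRadial,
    integral_withDensity_eq_integral_smul (measurable_gffDensity σ),
    integral_withDensity_eq_integral_smul (measurable_gffDensity σ)]
  simp [diagEmb, adiagEmb, ENNReal.toReal_inv]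
  ring

/-! ## 2. `χ_u` on the diagonals: two Frullani kernels -/

section Chi

variable (x₁ y₁ x₁' y₁' x₂ y₂ : ℝ)

/-- The complex increments `w₁ = x₁ + iy₁`, `w' = x₁' + iy₁'`, `w₂ = x₂ + iy₂`. [folklore] -/
def cx (x y : ℝ) : ℂ := (x : ℂ) + Complex.I * y

/-- `e^{-ax-iby}` at `b = a` is `e^{-a(x+iy)}`. [folklore] -/
theorem cexp_diag (a x y : ℝ) :
    Complex.exp (-((a : ℂ) * x + Complex.I * (a : ℂ) * y)) = Complex.exp (-(cx x y * a)) := by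
  congr 1; simp only [cx]; ring

/-- **On the diagonal, `χ_u(a,a)/a` is the sum of two Frullani kernels**:
`χ_u(a,a) = [e^{-a(w₂+w')} - e^{-aw'}] + [e^{-a(w'+w₁)} - e^{-a(w₁+w'+w₂)}]`.
[cite: DKLM2026SixVertexGFF, Part II §1.1] -/
theorem chiCont_diag (a : ℝ) (ha : 0 < a) :
    chiCont x₁ y₁ x₁' y₁' x₂ y₂ (a, a) =
      (a : ℂ) * (frullaniKernel (cx x₂ y₂ + cx x₁' y₁') (cx x₁' y₁') a +
        frullaniKernel (cx x₁' y₁' + cx x₁ y₁) (cx x₁ y₁ + cx x₁' y₁' + cx x₂ y₂) a) := by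
  have ha' : (a : ℂ) ≠ 0 := by exact_mod_cast ha.ne'
  simp only [chiCont, frullaniKernel, cexp_diag]
  rw [show -( (cx x₂ y₂ + cx x₁' y₁') * a) = -(cx x₂ y₂ * a) + -(cx x₁' y₁' * a) by ring, Complex.exp_add,
    show -((cx x₁' y₁' + cx x₁ y₁) * a) = -(cx x₁' y₁' * a) + -(cx x₁ y₁ * a) by ring, Complex.exp_add,
    show -((cx x₁ y₁ + cx x₁' y₁' + cx x₂ y₂) * a) = -(cx x₁ y₁ * a) + -(cx x₁' y₁' * a) + -(cx x₂ y₂ * a) by ring,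
    Complex.exp_add, Complex.exp_add]
  field_simp
  ring

/-- **On the anti-diagonal, `χ_u(a,-a)` is the complex conjugate of `χ_u(a,a)`.**
[cite: DKLM2026SixVertexGFF, Part II §1.1 (invariance under `b ↦ -b`)] -/
theorem chiCont_adiag (a : ℝ) :
    chiCont x₁ y₁ x₁' y₁' x₂ y₂ (a, -a) = (starRingEnd ℂ) (chiCont x₁ y₁ x₁' y₁' x₂ y₂ (a, a)) := by
  have h : ∀ x y : ℝ, Complex.exp (-((a : ℂ) * x + Complex.I * ((-a : ℝ) : ℂ) * y)) =
      (starRingEnd ℂ) (Complex.exp (-((a : ℂ) * x + Complex.I * (a : ℂ) * y))) := by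
    intro x y
    rw [← Complex.exp_conj]
    congr 1
    simp only [map_neg, map_add, map_mul, Complex.conj_ofReal, Complex.conj_I, Complex.ofReal_neg]
    ring
  simp only [chiCont, h, map_mul, map_sub, map_one]

end Chi

/-! ## 3. `∫ χ_u dμ_σ = σ² Ψ₂^GFF(u)` -/

/-- Integrability of a density-weighted Frullani kernel on `(0,∞)`. [folklore] -/
theorem integrable_gffDensity_smul_mul_frullaniKernel (σ : ℝ) {α β : ℂ} (hα : 0 < α.re) (hβ : 0 < β.re) :
    Integrable (fun a : ℝ => gffDensity σ a • ((a : ℂ) * frullaniKernel α β a)) (volume.restrict (Ioi (0 : ℝ))) := by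
  have h := (integrableOn_frullaniKernel hα hβ).const_mul ((σ ^ 2 / (2 * Real.pi) : ℝ) : ℂ)
  refine (integrable_congr ?_).1 h
  rw [EventuallyEq, ae_restrict_iff' measurableSet_Ioi]
  refine ae_of_all _ fun a (ha : 0 < a) => ?_
  rw [NNReal.smul_def, coe_gffDensity ha, Complex.real_smul]
  have ha' : (a : ℂ) ≠ 0 := by exact_mod_cast ha.ne'
  push_cast
  field_simp

/-- The weighted diagonal integral: `∫₀^∞ χ_u(a,a) σ²/(2πa) da = (σ²/2π)(L)`,
`L = Log w' - Log(w₂+w') + Log(w₁+w'+w₂) - Log(w'+w₁)`.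
[cite: DKLM2026SixVertexGFF, Part II §1.1 and Theorem 53] -/
theorem integral_gffDensity_smul_chiCont_diag (σ x₁ y₁ x₁' y₁' x₂ y₂ : ℝ) (hx₁ : 0 ≤ x₁) (hx₁' : 0 < x₁') (hx₂ : 0 ≤ x₂) :
    ∫ a in Ioi (0 : ℝ), gffDensity σ a • chiCont x₁ y₁ x₁' y₁' x₂ y₂ (a, a) =
      ((σ ^ 2 / (2 * Real.pi) : ℝ) : ℂ) *
        ((Complex.log (cx x₁' y₁') - Complex.log (cx x₂ y₂ + cx x₁' y₁')) +
          (Complex.log (cx x₁ y₁ + cx x₁' y₁' + cx x₂ y₂) - Complex.log (cx x₁' y₁' + cx x₁ y₁))) := by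
  have r1 : 0 < (cx x₂ y₂ + cx x₁' y₁').re := by simp [cx]; linarith
  have r2 : 0 < (cx x₁' y₁').re := by simp [cx]; linarith
  have r3 : 0 < (cx x₁' y₁' + cx x₁ y₁).re := by simp [cx]; linarith
  have r4 : 0 < (cx x₁ y₁ + cx x₁' y₁' + cx x₂ y₂).re := by simp [cx]; linarith
  have hI1 := integrable_gffDensity_smul_mul_frullaniKernel σ r1 r2
  have hI2 := integrable_gffDensity_smul_mul_frullaniKernel σ r3 r4
  -- rewrite the integrand on `(0,∞)`
  have heq : ∀ a ∈ Ioi (0 : ℝ), gffDensity σ a • chiCont x₁ y₁ x₁' y₁' x₂ y₂ (a, a) =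
      gffDensity σ a • ((a : ℂ) * frullaniKernel (cx x₂ y₂ + cx x₁' y₁') (cx x₁' y₁') a) +
        gffDensity σ a • ((a : ℂ) * frullaniKernel (cx x₁' y₁' + cx x₁ y₁) (cx x₁ y₁ + cx x₁' y₁' + cx x₂ y₂) a) := by
    intro a ha
    rw [chiCont_diag x₁ y₁ x₁' y₁' x₂ y₂ a ha, mul_add, smul_add]
  rw [setIntegral_congr_fun measurableSet_Ioi heq, integral_add hI1 hI2]
  -- each piece is a constant times a Frullani integral
  have hpiece : ∀ {α β : ℂ}, 0 < α.re → 0 < β.re →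
      ∫ a in Ioi (0 : ℝ), gffDensity σ a • ((a : ℂ) * frullaniKernel α β a) =
        ((σ ^ 2 / (2 * Real.pi) : ℝ) : ℂ) * (Complex.log β - Complex.log α) := by
    intro α β hα hβ
    rw [← integral_frullani_cexp hα hβ, ← integral_const_mul]
    refine setIntegral_congr_fun measurableSet_Ioi fun a (ha : 0 < a) => ?_
    rw [NNReal.smul_def, coe_gffDensity ha, Complex.real_smul, frullaniKernel]
    have ha' : (a : ℂ) ≠ 0 := by exact_mod_cast ha.ne'
    push_cast
    field_simp
  rw [hpiece r1 r2, hpiece r3 r4]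
  ring

/-- The anti-diagonal integral is the complex conjugate of the diagonal one.
[cite: DKLM2026SixVertexGFF, Part II §1.1] -/
theorem integral_gffDensity_smul_chiCont_adiag (σ x₁ y₁ x₁' y₁' x₂ y₂ : ℝ) :
    ∫ a in Ioi (0 : ℝ), gffDensity σ a • chiCont x₁ y₁ x₁' y₁' x₂ y₂ (a, -a) =
      (starRingEnd ℂ) (∫ a in Ioi (0 : ℝ), gffDensity σ a • chiCont x₁ y₁ x₁' y₁' x₂ y₂ (a, a)) := by
  rw [← integral_conj]
  refine integral_congr_ae (ae_of_all _ fun a => ?_)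
  dsimp only
  rw [chiCont_adiag, NNReal.smul_def, NNReal.smul_def, Complex.real_smul, Complex.real_smul, map_mul,
    Complex.conj_ofReal]

/-- `Re (Log w) = log |w|` as a complex identity: `Log w + conj (Log w) = 2 log|w|`. [folklore] -/
theorem log_add_conj_log (w : ℂ) : Complex.log w + (starRingEnd ℂ) (Complex.log w) = ((2 * Real.log ‖w‖ : ℝ) : ℂ) := by
  rw [Complex.add_conj, Complex.log_re]

/-- **The "if" direction of the simple exercise / consistency of Theorem 53**: for horizontally
ordered `u = (u₁,u₁',u₂,u₂')` with `x₁' = Re(u₂ - u₁') > 0` (and `x₁, x₂ ≥ 0`),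
`∫ χ_u dμ_σ = σ² Ψ₂^GFF(u)`, where `χ_u` is taken with `(x₁,y₁) = u₁' - u₁`,
`(x₁',y₁') = u₂ - u₁'`, `(x₂,y₂) = u₂' - u₂`.
[cite: DKLM2026SixVertexGFF, Part II §1.1 and Theorem 53] -/
theorem integral_chiCont_gffSpectralMeasure (σ : ℝ) (u : Fin 2 → ℂ × ℂ) (hx₁ : 0 ≤ ((u 0).2 - (u 0).1).re)
    (hx₁' : 0 < ((u 1).1 - (u 0).2).re) (hx₂ : 0 ≤ ((u 1).2 - (u 1).1).re) :
    ∫ p, chiCont ((u 0).2 - (u 0).1).re ((u 0).2 - (u 0).1).im ((u 1).1 - (u 0).2).re ((u 1).1 - (u 0).2).im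
        ((u 1).2 - (u 1).1).re ((u 1).2 - (u 1).1).im p ∂gffSpectralMeasure σ =
      ((σ ^ 2 * gffKPoint 2 u : ℝ) : ℂ) := by
  -- abbreviations for the increments
  set w₁ : ℂ := (u 0).2 - (u 0).1 with hw₁
  set w' : ℂ := (u 1).1 - (u 0).2 with hw'
  set w₂ : ℂ := (u 1).2 - (u 1).1 with hw₂
  have e₁ : cx w₁.re w₁.im = w₁ := Complex.re_add_im w₁ ▸ by simp [cx, mul_comm]
  have e' : cx w'.re w'.im = w' := Complex.re_add_im w' ▸ by simp [cx, mul_comm]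
  have e₂ : cx w₂.re w₂.im = w₂ := Complex.re_add_im w₂ ▸ by simp [cx, mul_comm]
  have hcont := continuous_chiCont w₁.re w₁.im w'.re w'.im w₂.re w₂.im
  -- integrability on both diagonals
  have r1 : 0 < (cx w₂.re w₂.im + cx w'.re w'.im).re := by simp [cx]; linarith
  have r2 : 0 < (cx w'.re w'.im).re := by simp [cx]; linarith
  have r3 : 0 < (cx w'.re w'.im + cx w₁.re w₁.im).re := by simp [cx]; linarith
  have r4 : 0 < (cx w₁.re w₁.im + cx w'.re w'.im + cx w₂.re w₂.im).re := by simp [cx]; linarith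
  have hdiag_int : Integrable (fun a => gffDensity σ a • chiCont w₁.re w₁.im w'.re w'.im w₂.re w₂.im (a, a))
      (volume.restrict (Ioi (0 : ℝ))) := by
    have h := (integrable_gffDensity_smul_mul_frullaniKernel σ r1 r2).add
      (integrable_gffDensity_smul_mul_frullaniKernel σ r3 r4)
    refine (integrable_congr ?_).1 h
    rw [EventuallyEq, ae_restrict_iff' measurableSet_Ioi]
    refine ae_of_all _ fun a (ha : 0 < a) => ?_
    simp only [Pi.add_apply]
    rw [chiCont_diag _ _ _ _ _ _ a ha, mul_add, smul_add]
  have hadiag_int : Integrable (fun a => gffDensity σ a • chiCont w₁.re w₁.im w'.re w'.im w₂.re w₂.im (a, -a))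
      (volume.restrict (Ioi (0 : ℝ))) := by
    have h := (Complex.conjLIE.toContinuousLinearEquiv.toContinuousLinearMap.integrable_comp hdiag_int)
    refine (integrable_congr ?_).1 h
    refine ae_of_all _ fun a => ?_
    dsimp only
    rw [chiCont_adiag, NNReal.smul_def, NNReal.smul_def, Complex.real_smul, Complex.real_smul]
    simp [map_mul, Complex.conj_ofReal]
  rw [integral_gffSpectralMeasure hcont hdiag_int hadiag_int, integral_gffDensity_smul_chiCont_adiag,
    integral_gffDensity_smul_chiCont_diag σ _ _ _ _ _ _ hx₁ hx₁' hx₂, e₁, e', e₂]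
  -- `L + conj L = 2 Re L`, `Re Log = log |·|`
  rw [map_mul, Complex.conj_ofReal]
  have key : ∀ c : ℝ, ∀ L : ℂ, (2⁻¹ : ℂ) * ((c : ℂ) * L + (c : ℂ) * (starRingEnd ℂ) L) = (c : ℂ) * ((L.re : ℝ) : ℂ) := by
    intro c L
    rw [← mul_add, Complex.add_conj]
    push_cast
    ring
  rw [key]
  simp only [Complex.sub_re, Complex.add_re, Complex.log_re]
  -- identify the norms with the point differences
  have n1 : ‖w'‖ = ‖(u 1).1 - (u 0).2‖ := rfl
  have n2 : ‖w₂ + w'‖ = ‖(u 1).2 - (u 0).2‖ := by rw [hw₂, hw']; ring_nf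
  have n3 : ‖w₁ + w' + w₂‖ = ‖(u 1).2 - (u 0).1‖ := by rw [hw₁, hw', hw₂]; ring_nf
  have n4 : ‖w' + w₁‖ = ‖(u 1).1 - (u 0).1‖ := by rw [hw', hw₁]; ring_nf
  rw [n1, n2, n3, n4, gffKPoint_two]
  simp only [greenPlane]
  push_cast
  ring

/-! ## 4. `μ_σ ∈ 𝓜_{c,C}` -/

/-- The mass of a set under `μ_σ` in terms of the radial measure of the two diagonal preimages.
[cite: DKLM2026SixVertexGFF, Theorem 53] -/
theorem gffSpectralMeasure_apply (σ : ℝ) {s : Set (ℝ × ℝ)} (hs : MeasurableSet s) :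
    gffSpectralMeasure σ s = 2⁻¹ * (gffRadial σ (diagEmb ⁻¹' s) + gffRadial σ (adiagEmb ⁻¹' s)) := by
  rw [gffSpectralMeasure, Measure.smul_apply, smul_eq_mul, Measure.add_apply, Measure.map_apply measurable_diagEmb hs,
    Measure.map_apply measurable_adiagEmb hs]

/-- The radial measure is carried by `(0,∞)`. [cite: DKLM2026SixVertexGFF, Theorem 53] -/
theorem gffRadial_null_of_subset_nonpos (σ : ℝ) {t : Set ℝ} (ht : t ⊆ {a : ℝ | a ≤ 0}) : gffRadial σ t = 0 := by
  refine withDensity_absolutelyContinuous _ _ (measure_mono_null ht ?_)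
  rw [Measure.restrict_apply (show MeasurableSet {a : ℝ | a ≤ 0} from measurableSet_Iic)]
  convert measure_empty (μ := (volume : Measure ℝ))
  ext a
  simp only [mem_inter_iff, mem_setOf_eq, mem_Ioi, mem_empty_iff_false, iff_false, not_and, not_lt]
  exact fun h => h

/-- **The radial mass of a dyadic window**: `∫_α^{2α} σ²/(2πa) da = (σ²/2π) log 2`.
[cite: DKLM2026SixVertexGFF, Part II, Definition 29 (i) for the limit measure] -/
theorem gffRadial_Ioo (σ : ℝ) {α : ℝ} (hα : 0 < α) :
    gffRadial σ (Ioo α (2 * α)) = ENNReal.ofReal (σ ^ 2 / (2 * Real.pi) * Real.log 2) := by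
  rw [gffRadial, withDensity_apply _ measurableSet_Ioo, Measure.restrict_restrict measurableSet_Ioo,
    show Ioo α (2 * α) ∩ Ioi 0 = Ioo α (2 * α) from inter_eq_left.2 fun a ha => hα.trans ha.1]
  have hint : IntegrableOn (fun a : ℝ => σ ^ 2 / (2 * Real.pi * a)) (Ioo α (2 * α)) := by
    refine (ContinuousOn.integrableOn_Icc (a := α) (b := 2 * α) ?_).mono_set Ioo_subset_Icc_self
    exact ContinuousOn.div continuousOn_const (by fun_prop) fun a ha =>
      (mul_pos (mul_pos two_pos Real.pi_pos) (hα.trans_le ha.1)).ne'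
  have hnn : 0 ≤ᵐ[volume.restrict (Ioo α (2 * α))] fun a : ℝ => σ ^ 2 / (2 * Real.pi * a) := by
    rw [EventuallyLE, ae_restrict_iff' measurableSet_Ioo]
    exact ae_of_all _ fun a ha => by have := hα.trans ha.1; positivity
  have hcoe : ∀ a : ℝ, ((gffDensity σ a : ℝ≥0) : ℝ≥0∞) = ENNReal.ofReal (σ ^ 2 / (2 * Real.pi * a)) := fun a => rfl
  simp_rw [hcoe]
  rw [← ofReal_integral_eq_lintegral_ofReal hint hnn]
  congr 1
  have h2α : α ≤ 2 * α := by linarith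
  rw [← integral_Ioc_eq_integral_Ioo, ← intervalIntegral.integral_of_le h2α]
  have : (fun a : ℝ => σ ^ 2 / (2 * Real.pi * a)) = fun a => σ ^ 2 / (2 * Real.pi) * a⁻¹ := by
    funext a; rw [div_mul_eq_div_div, div_eq_mul_inv]
  rw [this, intervalIntegral.integral_const_mul, integral_inv_of_pos hα (by linarith),
    show 2 * α / α = 2 by field_simp]

/-- **The GFF spectral measure belongs to `𝓜_{c,C}`** (Definition 29) for every `c`, with
`C = (σ²/2π) log 2`: bound (i) is an equality on every dyadic window and bound (ii) is vacuous,
the measure being carried by `{|b| = a}`. [cite: DKLM2026SixVertexGFF, Part II, Definition 29 and Theorem 53] -/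
theorem gffSpectralMeasure_mem_dklmSpaceM (σ c : ℝ) :
    gffSpectralMeasure σ ∈ dklmSpaceM c (σ ^ 2 / (2 * Real.pi) * Real.log 2) := by
  refine ⟨?_, ?_, fun α hα => ?_, fun α β hα hαβ => ?_⟩
  · rw [gffSpectralMeasure_apply σ (measurableSet_le measurable_fst measurable_const),
      gffRadial_null_of_subset_nonpos σ (t := diagEmb ⁻¹' {p : ℝ × ℝ | p.1 ≤ 0}) (fun a ha => ha),
      gffRadial_null_of_subset_nonpos σ (t := adiagEmb ⁻¹' {p : ℝ × ℝ | p.1 ≤ 0}) (fun a ha => ha)]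
    simp
  · have hR : Measurable (fun p : ℝ × ℝ => (p.1, -p.2)) := measurable_fst.prodMk measurable_snd.neg
    have h1 : (fun p : ℝ × ℝ => (p.1, -p.2)) ∘ diagEmb = adiagEmb := rfl
    have h2 : (fun p : ℝ × ℝ => (p.1, -p.2)) ∘ adiagEmb = diagEmb := by
      funext a; simp [diagEmb, adiagEmb]
    rw [gffSpectralMeasure, Measure.map_smul, Measure.map_add _ _ hR, Measure.map_map hR measurable_diagEmb,
      Measure.map_map hR measurable_adiagEmb, h1, h2, add_comm]
  · rw [gffSpectralMeasure_apply σ (show MeasurableSet {p : ℝ × ℝ | p.1 ∈ Ioo α (2 * α)} from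
      measurableSet_Ioo.preimage measurable_fst)]
    have e1 : diagEmb ⁻¹' {p : ℝ × ℝ | p.1 ∈ Ioo α (2 * α)} = Ioo α (2 * α) := rfl
    have e2 : adiagEmb ⁻¹' {p : ℝ × ℝ | p.1 ∈ Ioo α (2 * α)} = Ioo α (2 * α) := rfl
    rw [e1, e2, gffRadial_Ioo σ hα, ← two_mul, ← mul_assoc, ENNReal.inv_mul_cancel (by norm_num) (by norm_num), one_mul]
  · have hmeas : MeasurableSet {p : ℝ × ℝ | p.1 ∈ Ioo 0 α ∧ |p.2| ∈ Ioo β (2 * β)} :=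
      (measurableSet_Ioo.preimage measurable_fst).inter (measurableSet_Ioo.preimage (continuous_abs.measurable.comp measurable_snd))
    rw [gffSpectralMeasure_apply σ hmeas]
    have e1 : diagEmb ⁻¹' {p : ℝ × ℝ | p.1 ∈ Ioo 0 α ∧ |p.2| ∈ Ioo β (2 * β)} = ∅ := by
      ext a
      simp only [mem_preimage, diagEmb, mem_setOf_eq, mem_Ioo, mem_empty_iff_false, iff_false, not_and]
      rintro ⟨h0, haα⟩ hβa
      rw [abs_of_pos h0] at hβa
      linarith
    have e2 : adiagEmb ⁻¹' {p : ℝ × ℝ | p.1 ∈ Ioo 0 α ∧ |p.2| ∈ Ioo β (2 * β)} = ∅ := by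
      ext a
      simp only [mem_preimage, adiagEmb, mem_setOf_eq, mem_Ioo, mem_empty_iff_false, iff_false, not_and, abs_neg]
      rintro ⟨h0, haα⟩ hβa
      rw [abs_of_pos h0] at hβa
      linarith
    rw [e1, e2, measure_empty, add_zero, mul_zero]
    exact zero_le

end Literature.Probability.LatticeModels.SixVertex

end
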